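import Summits.Ventures.Crystal3D.Theorems.StickyWulffConstantCoaxialWallLawIncoherentCount
import HarnessLib

/-!
# Incoherent translation pairs IV: ARBITRARY fillings pay the whole free surface up to `12` per FILLER ball —
# the stub's inequality at `½` whenever the third material is thin (`≤ C_F (1+h) ρ` balls off both lattices)

HONEST FRAMING. Venture `Summits/Ventures/Crystal3D` (cell `crystal3d-full`), helper `--supports` the crux
`CoaxialWallLaw` (stmt-Ventures-19481, `route-Ventures-StickyWulffConstant`), REGISTERED line `WallLedgerF` (planner
cf-p1), open stub `stub_coaxialTwoSlabAdhesion`.  Rung credit only; F-C1 not moved.  Memo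
HOME/wall-19481-p2/F-TWOPLATE-g5.md §6.  For an INCOHERENT translation pair (`τ + Λ₀` carries no unit vector — generic,
and all of class (A); the grains never touch, `…IncoherentOffset`) and an ARBITRARY filling `X`, split
`X = X' ⊔ F` into the balls ON one of the two lattices (`X'`) and the FILLER `F` (off both).  The rigid count
`translate_deficit_ge_incoherent_rigid` (`…IncoherentCount`) applied to the sub-configuration `X'` (still `1`-separated,
still containing both complete samples) gives `Σ_{X' ∩ window} (12 − deg_{X'}) ≥ 2φ₁·πρ² − O(ρ)`; a filler ball has at
most twelve contacts (kissing), so restoring `F` raises the degrees of `X'`-balls by at most `12·#F` in total: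

* `translate_deficit_ge_incoherent_filler` — ANY filling `X ⊆ Λ₁ ∪ Λ₂ ∪ F`: `Σ_window (12 − deg) ≥ 2φ₁·πρ² − 12(12√2π + 36R₀ + 144)ρ − 12·#F`;
* **`translate_twoSlabAdhesion_incoherent_of_thinFiller`** — for every `C_F`: fillings with `#F ≤ C_F (1+h) ρ` obey the
  stub's inequality with adhesion term `φ₁ + φ₂ − φ₁` (nothing recovered by the bottom grain);
* **`coaxialTwoSlabAdhesion_classA_of_thinFiller`** — class (A), `Λ₁ ≠ Λ₂`, `#F ≤ C_F (1+h) ρ`: the stub's inequality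
  VERBATIM at `(1/2)·√(1 − ⟪L e₃, e₃⟫²)` for every frame `L`.  Inputs: NONE (no kissing facts beyond Musin's twelve,
  no census).

The incoherent analogue of 19481-p1's `coaxialTwoSlabAdhesion_of_thinOffPlane` (thin off-plane material on the
site-lattice class).  WHAT THIS IS NOT: thick third material (a mediating grain: the census-free record there is the
word lane's `φ₁/39` / `(√6/78)·sin θ'`); the stub; F-C1 not moved.
-/

noncomputable section

namespace Summit.Ventures.Crystal3D.Theorems

open Summit.Ventures.Crystal3D Finset NearIdentity
open Literature.MathematicalPhysics.StatisticalMechanics (fccStacking barlowStacking constHagg IsHaggSeq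
  contactDeficiency)
open scoped InnerProductSpace

open scoped Classical in
/-- **The deficit count for an incoherent translation pair, arbitrary filling, up to `12` per filler ball.**  See
the module docstring. -/
theorem translate_deficit_ge_incoherent_filler
    (A : EuclideanSpace ℝ (Fin 3) ≃ₗᵢ[ℝ] EuclideanSpace ℝ (Fin 3)) (t₁ t₂ : EuclideanSpace ℝ (Fin 3))
    (hA : ∀ q ∈ fccStacking 1 (Real.sqrt (2 / 3)), ‖q + A.symm (t₂ - t₁)‖ ≠ 1)
    (X P₁ P₂ : Finset (EuclideanSpace ℝ (Fin 3))) (R₀ h ρ : ℝ)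
    (hR₀ : 10 ≤ R₀) (hh : 0 ≤ h) (hρ : R₀ ≤ ρ)
    (hX : ∀ p ∈ X, ∀ q ∈ X, p ≠ q → 1 ≤ dist p q)
    (hcell : ∀ p ∈ X, -(2 * R₀) ≤ p 2 ∧ p 2 ≤ h + 2 * R₀ ∧ p 0 ^ 2 + p 1 ^ 2 ≤ ρ ^ 2)
    (hP₁X : P₁ ⊆ X) (hP₂X : P₂ ⊆ X)
    (hP₁ : ∀ p, p ∈ P₁ ↔ (p ∈ (fun q => A q + t₁) '' fccStacking 1 (Real.sqrt (2 / 3)) ∧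
      -(2 * R₀) ≤ p 2 ∧ p 2 ≤ -R₀ ∧ p 0 ^ 2 + p 1 ^ 2 ≤ ρ ^ 2))
    (hP₂ : ∀ p, p ∈ P₂ ↔ (p ∈ (fun q => A q + t₂) '' fccStacking 1 (Real.sqrt (2 / 3)) ∧
      h + R₀ ≤ p 2 ∧ p 2 ≤ h + 2 * R₀ ∧ p 0 ^ 2 + p 1 ^ 2 ≤ ρ ^ 2))
    (F : Finset (EuclideanSpace ℝ (Fin 3)))
    (hF : ∀ x ∈ X, x ∈ (fun q => A q + t₁) '' fccStacking 1 (Real.sqrt (2 / 3)) ∨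
      x ∈ (fun q => A q + t₂) '' fccStacking 1 (Real.sqrt (2 / 3)) ∨ x ∈ F) :
    2 * (Real.sqrt 2 / 4 * ∑ᶠ w ∈ {w ∈ fccStacking 1 (Real.sqrt (2 / 3)) | ‖w‖ = 1},
        |⟪w, A.symm (EuclideanSpace.single (2 : Fin 3) (1 : ℝ))⟫_ℝ|) * Real.pi * ρ ^ 2 -
        12 * (12 * Real.sqrt 2 * Real.pi + 36 * R₀ + 144) * ρ - 12 * (F.card : ℝ) ≤
      ∑ z ∈ X.filter (fun z => -R₀ - 2 ≤ z 2 ∧ z 2 ≤ h + R₀ + 2),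
        ((12 : ℝ) - ((X.filter fun q => dist z q = 1).card : ℝ)) := by
  set Λ₁ := (fun q => A q + t₁) '' fccStacking 1 (Real.sqrt (2 / 3)) with hΛ₁
  set Λ₂ := (fun q => A q + t₂) '' fccStacking 1 (Real.sqrt (2 / 3)) with hΛ₂
  set Fx := X.filter (fun x => x ∉ Λ₁ ∧ x ∉ Λ₂) with hFx
  set X' := X.filter (fun x => x ∈ Λ₁ ∨ x ∈ Λ₂) with hX'
  have hX'X : X' ⊆ X := filter_subset _ _
  have hFxF : Fx ⊆ F := by
    intro x hx
    obtain ⟨hxX, h1, h2⟩ := mem_filter.1 hx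
    rcases hF x hxX with h' | h' | h'
    · exact absurd h' h1
    · exact absurd h' h2
    · exact h'
  have hFcard : (Fx.card : ℝ) ≤ (F.card : ℝ) := by exact_mod_cast card_le_card hFxF
  -- the rigid count on the lattice part
  have hX'sep : ∀ p ∈ X', ∀ q ∈ X', p ≠ q → 1 ≤ dist p q := fun p hp q hq => hX p (hX'X hp) q (hX'X hq)
  have hcell' : ∀ p ∈ X', -(2 * R₀) ≤ p 2 ∧ p 2 ≤ h + 2 * R₀ ∧ p 0 ^ 2 + p 1 ^ 2 ≤ ρ ^ 2 :=
    fun p hp => hcell p (hX'X hp)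
  have hP₁X' : P₁ ⊆ X' := fun p hp => mem_filter.2 ⟨hP₁X hp, Or.inl ((hP₁ p).1 hp).1⟩
  have hP₂X' : P₂ ⊆ X' := fun p hp => mem_filter.2 ⟨hP₂X hp, Or.inr ((hP₂ p).1 hp).1⟩
  have hrig : ∀ x ∈ X', x ∈ Λ₁ ∨ x ∈ Λ₂ := fun x hx => (mem_filter.1 hx).2
  have hcount := translate_deficit_ge_incoherent_rigid A t₁ t₂ hA X' P₁ P₂ R₀ h ρ hR₀ hh hρ hX'sep hcell' hP₁X' hP₂X'
    hP₁ hP₂ hrig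
  -- windows
  set W := X.filter (fun z => -R₀ - 2 ≤ z 2 ∧ z 2 ≤ h + R₀ + 2) with hW
  set W' := X'.filter (fun z => -R₀ - 2 ≤ z 2 ∧ z 2 ≤ h + R₀ + 2) with hW'
  have hW'W : W' ⊆ W := fun z hz => mem_filter.2 ⟨hX'X (mem_filter.1 hz).1, (mem_filter.1 hz).2⟩
  -- (1) degrees in `X` vs in `X'`: the difference is the filler contacts
  have hdeg : ∀ z, ((X.filter fun q => dist z q = 1).card : ℝ) ≤
      ((X'.filter fun q => dist z q = 1).card : ℝ) + ((Fx.filter fun q => dist z q = 1).card : ℝ) := by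
    intro z
    have hsub : (X.filter fun q => dist z q = 1) ⊆ (X'.filter fun q => dist z q = 1) ∪ (Fx.filter fun q => dist z q = 1) := by
      intro q hq
      obtain ⟨hqX, hd⟩ := mem_filter.1 hq
      by_cases h' : q ∈ Λ₁ ∨ q ∈ Λ₂
      · exact mem_union_left _ (mem_filter.2 ⟨mem_filter.2 ⟨hqX, h'⟩, hd⟩)
      · push Not at h'
        exact mem_union_right _ (mem_filter.2 ⟨mem_filter.2 ⟨hqX, h'⟩, hd⟩)
    have h1 := (card_le_card hsub).trans (card_union_le _ _)
    exact_mod_cast h1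
  -- (2) the filler contacts, double counted: each filler ball has at most twelve contacts
  have hfill : ∑ z ∈ W', ((Fx.filter fun q => dist z q = 1).card : ℝ) ≤ 12 * (Fx.card : ℝ) := by
    have e1 : ∀ z ∈ W', ((Fx.filter fun q => dist z q = 1).card : ℝ) = ∑ f ∈ Fx, if dist z f = 1 then (1 : ℝ) else 0 := by
      intro z _; rw [← sum_filter]; simp
    rw [sum_congr rfl e1, sum_comm]
    have e2 : ∀ f ∈ Fx, (∑ z ∈ W', if dist z f = 1 then (1 : ℝ) else 0) ≤ 12 := by
      intro f hf
      rw [← sum_filter]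
      simp only [sum_const, nsmul_eq_mul, mul_one]
      have hsub : (W'.filter fun z => dist z f = 1) ⊆ X.filter (fun q => dist f q = 1) := by
        intro z hz
        obtain ⟨hzW', hd⟩ := mem_filter.1 hz
        exact mem_filter.2 ⟨hX'X (mem_filter.1 hzW').1, by rw [dist_comm]; exact hd⟩
      have := (card_le_card hsub).trans (card_filter_dist_eq_one_le_twelve X hX f)
      exact_mod_cast this
    calc ∑ f ∈ Fx, ∑ z ∈ W', (if dist z f = 1 then (1 : ℝ) else 0) ≤ ∑ f ∈ Fx, (12 : ℝ) := sum_le_sum e2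
      _ = 12 * (Fx.card : ℝ) := by rw [sum_const, nsmul_eq_mul, mul_comm]
  -- (3) the window sum over `X` dominates the window sum over `X'` (the filler terms are nonnegative)
  have hsplit : ∑ z ∈ W', ((12 : ℝ) - ((X.filter fun q => dist z q = 1).card : ℝ)) ≤
      ∑ z ∈ W, ((12 : ℝ) - ((X.filter fun q => dist z q = 1).card : ℝ)) := by
    refine sum_le_sum_of_subset_of_nonneg hW'W fun z _ _ => ?_
    have := card_filter_dist_eq_one_le_twelve X hX z
    have : ((X.filter fun q => dist z q = 1).card : ℝ) ≤ 12 := by exact_mod_cast this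
    linarith
  -- (4) combine
  have hsum : ∑ z ∈ W', ((12 : ℝ) - ((X'.filter fun q => dist z q = 1).card : ℝ)) ≤
      ∑ z ∈ W', ((12 : ℝ) - ((X.filter fun q => dist z q = 1).card : ℝ)) +
        ∑ z ∈ W', ((Fx.filter fun q => dist z q = 1).card : ℝ) := by
    rw [← sum_add_distrib]
    exact sum_le_sum fun z _ => by linarith [hdeg z]
  linarith [hcount, hfill, hsplit, hsum, hFcard]

section Assembly

open scoped Classical in
/-- **Incoherent offset, thin filler: the bottom grain recovers nothing.**  See the module docstring. -/
theorem translate_twoSlabAdhesion_incoherent_of_thinFiller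
    (A₁ : EuclideanSpace ℝ (Fin 3) ≃ₗᵢ[ℝ] EuclideanSpace ℝ (Fin 3)) (t₁ : EuclideanSpace ℝ (Fin 3))
    (A₂ : EuclideanSpace ℝ (Fin 3) ≃ₗᵢ[ℝ] EuclideanSpace ℝ (Fin 3)) (t₂ : EuclideanSpace ℝ (Fin 3))
    (htrans : A₁ '' fccStacking 1 (Real.sqrt (2 / 3)) = A₂ '' fccStacking 1 (Real.sqrt (2 / 3)))
    (hA : ∀ q ∈ fccStacking 1 (Real.sqrt (2 / 3)), ‖q + A₁.symm (t₂ - t₁)‖ ≠ 1) (C_F : ℝ) :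
    ∃ C R₀ : ℝ, 1 ≤ R₀ ∧ ∀ h : ℝ, 0 ≤ h → ∀ ρ : ℝ, R₀ ≤ ρ →
      ∀ X P₁ P₂ : Finset (EuclideanSpace ℝ (Fin 3)),
      (∀ p ∈ X, ∀ q ∈ X, p ≠ q → 1 ≤ dist p q) → P₁ ⊆ X → P₂ ⊆ X \ P₁ →
      (∀ p ∈ X, -(2 * R₀) ≤ p 2 ∧ p 2 ≤ h + 2 * R₀ ∧ p 0 ^ 2 + p 1 ^ 2 ≤ ρ ^ 2) →
      (∀ p, p ∈ P₁ ↔ (p ∈ (fun q => A₁ q + t₁) '' fccStacking 1 (Real.sqrt (2 / 3)) ∧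
        -(2 * R₀) ≤ p 2 ∧ p 2 ≤ -R₀ ∧ p 0 ^ 2 + p 1 ^ 2 ≤ ρ ^ 2)) →
      (∀ p, p ∈ P₂ ↔ (p ∈ (fun q => A₂ q + t₂) '' fccStacking 1 (Real.sqrt (2 / 3)) ∧
        h + R₀ ≤ p 2 ∧ p 2 ≤ h + 2 * R₀ ∧ p 0 ^ 2 + p 1 ^ 2 ≤ ρ ^ 2)) →
      ∀ F : Finset (EuclideanSpace ℝ (Fin 3)),
      (∀ x ∈ X, x ∈ (fun q => A₁ q + t₁) '' fccStacking 1 (Real.sqrt (2 / 3)) ∨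
        x ∈ (fun q => A₂ q + t₂) '' fccStacking 1 (Real.sqrt (2 / 3)) ∨ x ∈ F) →
      (F.card : ℝ) ≤ C_F * (1 + h) * ρ →
      ((((P₁ ×ˢ (X \ P₁)).filter fun pq => dist pq.1 pq.2 = 1).card : ℕ) : ℝ) +
        ((((P₂ ×ˢ ((X \ P₁) \ P₂)).filter fun pq => dist pq.1 pq.2 = 1).card : ℕ) : ℝ) ≤
        contactDeficiency ((X \ P₁) \ P₂) +
          (Real.sqrt 2 / 4 * ∑ᶠ w ∈ {w ∈ fccStacking 1 (Real.sqrt (2 / 3)) | ‖w‖ = 1},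
              |⟪w, A₁.symm (EuclideanSpace.single (2 : Fin 3) (1 : ℝ))⟫_ℝ| +
            Real.sqrt 2 / 4 * ∑ᶠ w ∈ {w ∈ fccStacking 1 (Real.sqrt (2 / 3)) | ‖w‖ = 1},
              |⟪w, A₂.symm (EuclideanSpace.single (2 : Fin 3) (1 : ℝ))⟫_ℝ| -
            Real.sqrt 2 / 4 * ∑ᶠ w ∈ {w ∈ fccStacking 1 (Real.sqrt (2 / 3)) | ‖w‖ = 1},
              |⟪w, A₁.symm (EuclideanSpace.single (2 : Fin 3) (1 : ℝ))⟫_ℝ|) * Real.pi * ρ ^ 2 +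
          C * (1 + h) * ρ := by
  set φ₁ : ℝ := Real.sqrt 2 / 4 * ∑ᶠ w ∈ {w ∈ fccStacking 1 (Real.sqrt (2 / 3)) | ‖w‖ = 1},
      |⟪w, A₁.symm (EuclideanSpace.single (2 : Fin 3) (1 : ℝ))⟫_ℝ| with hφ₁
  -- the top grain in the bottom frame
  have hΛ₂ : (fun q => A₂ q + t₂) '' fccStacking 1 (Real.sqrt (2 / 3)) =
      (fun q => A₁ q + t₂) '' fccStacking 1 (Real.sqrt (2 / 3)) := by
    have e2 : (fun q => A₂ q + t₂) '' fccStacking 1 (Real.sqrt (2 / 3)) =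
        (fun y => y + t₂) '' (A₂ '' fccStacking 1 (Real.sqrt (2 / 3))) := by rw [Set.image_image]
    have e1 : (fun q => A₁ q + t₂) '' fccStacking 1 (Real.sqrt (2 / 3)) =
        (fun y => y + t₂) '' (A₁ '' fccStacking 1 (Real.sqrt (2 / 3))) := by rw [Set.image_image]
    rw [e2, e1, htrans]
  set K : ℝ := 12 * (12 * Real.sqrt 2 * Real.pi + 36 * 10 + 144) with hK
  have hK0 : 0 ≤ K := by positivity
  obtain ⟨C, hC⟩ := twoSlab_cross_le_of_deficit A₁ t₁ A₂ t₂ 10 le_rfl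
  refine ⟨C + (K + 12 * |C_F|) / 2, 10, by norm_num, ?_⟩
  intro h hh ρ hρ X P₁ P₂ hX hP₁X hP₂X₁ hcyl hP₁ hP₂ F hF hthin
  have hP₂X : P₂ ⊆ X := hP₂X₁.trans sdiff_subset
  have hρ0 : (0 : ℝ) ≤ ρ := by linarith
  have hP₂' : ∀ p, p ∈ P₂ ↔ (p ∈ (fun q => A₁ q + t₂) '' fccStacking 1 (Real.sqrt (2 / 3)) ∧
      h + 10 ≤ p 2 ∧ p 2 ≤ h + 2 * 10 ∧ p 0 ^ 2 + p 1 ^ 2 ≤ ρ ^ 2) := by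
    intro p; rw [hP₂, hΛ₂]
  have hF' : ∀ x ∈ X, x ∈ (fun q => A₁ q + t₁) '' fccStacking 1 (Real.sqrt (2 / 3)) ∨
      x ∈ (fun q => A₁ q + t₂) '' fccStacking 1 (Real.sqrt (2 / 3)) ∨ x ∈ F := by
    intro x hx; rw [← hΛ₂]; exact hF x hx
  have hcount := translate_deficit_ge_incoherent_filler A₁ t₁ t₂ hA X P₁ P₂ 10 h ρ le_rfl hh hρ hX hcyl hP₁X hP₂X
    hP₁ hP₂' F hF'
  rw [← hK, ← hφ₁] at hcount
  have hpay : 2 * φ₁ * Real.pi * ρ ^ 2 - (K + 12 * |C_F|) * (1 + h) * ρ ≤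
      ∑ z ∈ X.filter (fun z => -(10 : ℝ) - 2 ≤ z 2 ∧ z 2 ≤ h + 10 + 2),
        ((12 : ℝ) - ((X.filter fun q => dist z q = 1).card : ℝ)) := by
    have hKh : K * ρ ≤ K * (1 + h) * ρ := by
      have := mul_nonneg (mul_nonneg hK0 hh) hρ0; linarith only [this]
    have habs : C_F * (1 + h) * ρ ≤ |C_F| * (1 + h) * ρ := by
      have h1 : 0 ≤ (|C_F| - C_F) * ((1 + h) * ρ) := mul_nonneg (by linarith only [le_abs_self C_F]) (by positivity)
      linarith only [h1]
    linarith only [hcount, hKh, hthin, habs]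
  have key := hC h hh ρ hρ X P₁ P₂ hX hP₁X hP₂X₁ hcyl hP₁ hP₂ (2 * φ₁) (K + 12 * |C_F|) (by positivity) hpay
  have e : (2 * φ₁ : ℝ) / 2 = φ₁ := by ring
  rw [e] at key
  exact key

open scoped Classical in
/-- **CLASS (A) TRANSLATION PAIRS, THIN FILLER: THE STUB'S INEQUALITY AT `½·sin θ` FOR EVERY AXIS.**  See the
module docstring. -/
theorem coaxialTwoSlabAdhesion_classA_of_thinFiller
    (A₁ : EuclideanSpace ℝ (Fin 3) ≃ₗᵢ[ℝ] EuclideanSpace ℝ (Fin 3)) (t₁ : EuclideanSpace ℝ (Fin 3))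
    (A₂ : EuclideanSpace ℝ (Fin 3) ≃ₗᵢ[ℝ] EuclideanSpace ℝ (Fin 3)) (t₂ : EuclideanSpace ℝ (Fin 3))
    (htrans : A₁ '' fccStacking 1 (Real.sqrt (2 / 3)) = A₂ '' fccStacking 1 (Real.sqrt (2 / 3)))
    (hne : (fun p => A₁ p + t₁) '' fccStacking 1 (Real.sqrt (2 / 3)) ≠
      (fun p => A₂ p + t₂) '' fccStacking 1 (Real.sqrt (2 / 3)))
    (hall : ∀ i j : Fin 3, i ≠ j →
      (∃ z : ℤ, Real.sqrt 2 * cubicCoords (A₁.symm (t₂ - t₁)) i +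
          Real.sqrt 2 * cubicCoords (A₁.symm (t₂ - t₁)) j = z) ∧
      (∃ z : ℤ, Real.sqrt 2 * cubicCoords (A₁.symm (t₂ - t₁)) i -
          Real.sqrt 2 * cubicCoords (A₁.symm (t₂ - t₁)) j = z))
    (L : EuclideanSpace ℝ (Fin 3) ≃ₗᵢ[ℝ] EuclideanSpace ℝ (Fin 3)) (C_F : ℝ) :
    ∃ C R₀ : ℝ, 1 ≤ R₀ ∧ ∀ h : ℝ, 0 ≤ h → ∀ ρ : ℝ, R₀ ≤ ρ →
      ∀ X P₁ P₂ : Finset (EuclideanSpace ℝ (Fin 3)),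
      (∀ p ∈ X, ∀ q ∈ X, p ≠ q → 1 ≤ dist p q) → P₁ ⊆ X → P₂ ⊆ X \ P₁ →
      (∀ p ∈ X, -(2 * R₀) ≤ p 2 ∧ p 2 ≤ h + 2 * R₀ ∧ p 0 ^ 2 + p 1 ^ 2 ≤ ρ ^ 2) →
      (∀ p, p ∈ P₁ ↔ (p ∈ (fun q => A₁ q + t₁) '' fccStacking 1 (Real.sqrt (2 / 3)) ∧
        -(2 * R₀) ≤ p 2 ∧ p 2 ≤ -R₀ ∧ p 0 ^ 2 + p 1 ^ 2 ≤ ρ ^ 2)) →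
      (∀ p, p ∈ P₂ ↔ (p ∈ (fun q => A₂ q + t₂) '' fccStacking 1 (Real.sqrt (2 / 3)) ∧
        h + R₀ ≤ p 2 ∧ p 2 ≤ h + 2 * R₀ ∧ p 0 ^ 2 + p 1 ^ 2 ≤ ρ ^ 2)) →
      ∀ F : Finset (EuclideanSpace ℝ (Fin 3)),
      (∀ x ∈ X, x ∈ (fun q => A₁ q + t₁) '' fccStacking 1 (Real.sqrt (2 / 3)) ∨
        x ∈ (fun q => A₂ q + t₂) '' fccStacking 1 (Real.sqrt (2 / 3)) ∨ x ∈ F) →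
      (F.card : ℝ) ≤ C_F * (1 + h) * ρ →
      ((((P₁ ×ˢ (X \ P₁)).filter fun pq => dist pq.1 pq.2 = 1).card : ℕ) : ℝ) +
        ((((P₂ ×ˢ ((X \ P₁) \ P₂)).filter fun pq => dist pq.1 pq.2 = 1).card : ℕ) : ℝ) ≤
        contactDeficiency ((X \ P₁) \ P₂) +
          (Real.sqrt 2 / 4 * ∑ᶠ w ∈ {w ∈ fccStacking 1 (Real.sqrt (2 / 3)) | ‖w‖ = 1},
              |⟪w, A₁.symm (EuclideanSpace.single (2 : Fin 3) (1 : ℝ))⟫_ℝ| +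
            Real.sqrt 2 / 4 * ∑ᶠ w ∈ {w ∈ fccStacking 1 (Real.sqrt (2 / 3)) | ‖w‖ = 1},
              |⟪w, A₂.symm (EuclideanSpace.single (2 : Fin 3) (1 : ℝ))⟫_ℝ| -
            (1 / 2 : ℝ) * Real.sqrt (1 - ⟪L (EuclideanSpace.single (2 : Fin 3) (1 : ℝ)),
              (EuclideanSpace.single (2 : Fin 3) (1 : ℝ))⟫_ℝ ^ 2)) * Real.pi * ρ ^ 2 +
          C * (1 + h) * ρ := by
  set e₃ : EuclideanSpace ℝ (Fin 3) := EuclideanSpace.single (2 : Fin 3) (1 : ℝ) with he₃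
  set τ : EuclideanSpace ℝ (Fin 3) := A₁.symm (t₂ - t₁) with hτ
  have hτΛ : τ ∉ fccStacking 1 (Real.sqrt (2 / 3)) := offset_notMem_of_ne A₁ A₂ t₁ t₂ htrans hne
  have hA : ∀ q ∈ fccStacking 1 (Real.sqrt (2 / 3)), ‖q + A₁.symm (t₂ - t₁)‖ ≠ 1 :=
    allInt_norm_add_ne_one τ hall hτΛ
  obtain ⟨C, R₀, hR₀, hmain⟩ := translate_twoSlabAdhesion_incoherent_of_thinFiller A₁ t₁ A₂ t₂ htrans hA C_F
  refine ⟨C, R₀, hR₀, ?_⟩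
  intro h hh ρ hρ X P₁ P₂ hX hP₁X hP₂X₁ hcyl hP₁ hP₂ F hF hthin
  have key := hmain h hh ρ hρ X P₁ P₂ hX hP₁X hP₂X₁ hcyl hP₁ hP₂ F hF hthin
  have hsin : Real.sqrt (1 - ⟪L e₃, e₃⟫_ℝ ^ 2) ≤ 1 := by
    rw [show (1 : ℝ) = Real.sqrt 1 from Real.sqrt_one.symm]
    exact Real.sqrt_le_sqrt (by rw [Real.sqrt_one]; nlinarith [sq_nonneg ⟪L e₃, e₃⟫_ℝ])
  have hphi := two_phi_ge_one A₁
  have hc' : (1 / 2 : ℝ) * Real.sqrt (1 - ⟪L e₃, e₃⟫_ℝ ^ 2) ≤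
      Real.sqrt 2 / 4 * ∑ᶠ w ∈ {w ∈ fccStacking 1 (Real.sqrt (2 / 3)) | ‖w‖ = 1}, |⟪w, A₁.symm e₃⟫_ℝ| := by
    linarith only [hsin, hphi]
  have hπρ : 0 ≤ Real.pi * ρ ^ 2 := by positivity
  have := mul_le_mul_of_nonneg_right hc' hπρ
  linarith only [key, this]

end Assembly

end Summit.Ventures.Crystal3D.Theorems

end
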